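import Summits.AtomisticToContinuum.BoseEinsteinCondensation.Theorems.BECInsertionCorrectorCorrectorClosureFirstCorrectorBoundModes
import Summits.AtomisticToContinuum.BoseEinsteinCondensation.Theorems.BECInsertionCorrectorCorrectorClosureFirstCorrectorBoundDictionary
import Summits.AtomisticToContinuum.BoseEinsteinCondensation.Theorems.BECInsertionCorrectorCorrectorClosureTailModes
import HarnessLib

/-!
# Crux `CorrectorClosure` (stmt-AtomisticToContinuum-12058), line `residue-area-law` —
# stub `stub_firstCorrectorBound`, auxiliary file: the `N`-uniform bound of the finite mode sums (packaged)

Supports (does not close) stmt-AtomisticToContinuum-12058, route `BECInsertionCorrector`.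
One theorem, `modes_continuous_and_hMinusOneSqW_le`, packaging the estimate of the finite
tagged-mode sums `M(X) = ∑_{k ∈ S} (a_k(X') cos(p_k·y) + b_k(X') sin(p_k·y))`,
`a_k = 2(α_k∑ⱼcos(p_k·xⱼ) + β_k∑ⱼsin(p_k·xⱼ))`, `b_k = 2(α_k∑ⱼsin - β_k∑ⱼcos)`, in the form consumed
by the registered stub: under the per-mode dictionary `‖∑ⱼcos(p_k·xⱼ)‖²₋₁, ‖∑ⱼsin(p_k·xⱼ)‖²₋₁ ≤ C_K N/|p_k|²`,
for `L ≥ 1`, a finite `S ∌ 0` without antipodal pairs and coefficients with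
`α_k² + β_k² ≤ (L⁻³κ)²` and `∑_{k ∈ T} (α_k² + β_k²) ≤ L⁻³ C_U κ` for all finite `T`
(the sup bound and Parseval for the cell Fourier coefficients of `v^per`), `M` is continuous and
`‖M‖²₋₁ ≤ C_K (192κ² + C_Uκ) N`. Proof: orthogonality of the tagged modes
(`hMinusOneSqW_tail_modes_le`), the coefficient bound `‖a_k‖², ‖b_k‖² ≤ 8(α_k² + β_k²)C_KN/|p_k|²`
(`hMinusOneSqW_modeCoeff_le`), the lattice sum `∑_{k∈S}(α_k²+β_k²)/|k|² ≤ 96⌈L⌉(L⁻³κ)² + L⁻³C_Uκ/⌈L⌉²`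
(`sum_sq_div_nsq_le` at `K₀ = ⌈L⌉`) and `⌈L⌉ ≤ 2L`, `2/π² ≤ 1`. (Same mathematics as
`…FirstCorrectorBoundModeSum.lean`, stated once in packaged form.)
-/

noncomputable section

open MeasureTheory Filter Matrix Finset
open scoped ENNReal NNReal BigOperators

namespace Summit.AtomisticToContinuum.BoseEinsteinCondensation.Theorems.CorrectorClosure.ResidueAreaLaw

open Literature.MathematicalPhysics.QuantumManyBody.BoseGas
open Summit.AtomisticToContinuum.BoseEinsteinCondensation.Theorems.CorrectorClosure.HealingScaleKacInsertion
  (hMinusOneSqW_tail_modes_le continuous_vecTail_config continuous_cos_modePhase continuous_sin_modePhase)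

variable {N : ℕ} {L : ℝ}

/-- **The finite tagged-mode sums: continuity and the `N`-uniform `H₋₁` bound (packaged).** Under
the per-mode dictionary with constant `C_K ≥ 0`, for `L ≥ 1`, a finite `S ∌ 0` without antipodal
pairs and real coefficients with `α_k² + β_k² ≤ (L⁻³κ)²` (all `k`) and
`∑_{k ∈ T} (α_k² + β_k²) ≤ L⁻³ C_U κ` (all finite `T`), the tagged-mode sum
`M(X) = ∑_{k ∈ S} (2(α_k∑ⱼcos(p_k·xⱼ) + β_k∑ⱼsin(p_k·xⱼ)) cos(p_k·y) + 2(α_k∑ⱼsin - β_k∑ⱼcos) sin(p_k·y))`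
is continuous and `‖M‖²₋₁ ≤ C_K (192κ² + C_Uκ) N` for the product weight `Θ₀ ∘ vecTail`. [folklore] -/
theorem modes_continuous_and_hMinusOneSqW_le (hL1 : 1 ≤ L) {Θ₀ : Config N → ℝ}
    (hΘc : Continuous Θ₀) {CK : ℝ} (hCK : 0 ≤ CK)
    (hdict : ∀ k : Fin 3 → ℤ, k ≠ 0 →
      hMinusOneSqW L Θ₀
          (fun X : Config N => ∑ j, Real.cos (2 * Real.pi / L * ∑ i, (k i : ℝ) * X j i)) ≤
        ENNReal.ofReal (CK * N / ((2 * Real.pi / L) ^ 2 * ∑ i, (k i : ℝ) ^ 2)) ∧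
      hMinusOneSqW L Θ₀
          (fun X : Config N => ∑ j, Real.sin (2 * Real.pi / L * ∑ i, (k i : ℝ) * X j i)) ≤
        ENNReal.ofReal (CK * N / ((2 * Real.pi / L) ^ 2 * ∑ i, (k i : ℝ) ^ 2)))
    {S : Finset (Fin 3 → ℤ)} (hS0 : (0 : Fin 3 → ℤ) ∉ S) (hS : ∀ m ∈ S, -m ∉ S)
    (α β : (Fin 3 → ℤ) → ℝ) {κ CU : ℝ} (hκ : 0 ≤ κ) (hCU : 0 ≤ CU)
    (hA : ∀ k, α k ^ 2 + β k ^ 2 ≤ ((L ^ 3)⁻¹ * κ) ^ 2)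
    (hP : ∀ T : Finset (Fin 3 → ℤ), ∑ k ∈ T, (α k ^ 2 + β k ^ 2) ≤ (L ^ 3)⁻¹ * (CU * κ)) :
    Continuous (fun X : Config (N + 1) => ∑ k ∈ S,
          (2 * (α k * ∑ j, Real.cos (2 * Real.pi / L * ∑ i, (k i : ℝ) * vecTail X j i) +
                β k * ∑ j, Real.sin (2 * Real.pi / L * ∑ i, (k i : ℝ) * vecTail X j i)) *
              Real.cos (2 * Real.pi / L * ∑ i, (k i : ℝ) * X 0 i) +
            2 * (α k * ∑ j, Real.sin (2 * Real.pi / L * ∑ i, (k i : ℝ) * vecTail X j i) -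
                β k * ∑ j, Real.cos (2 * Real.pi / L * ∑ i, (k i : ℝ) * vecTail X j i)) *
              Real.sin (2 * Real.pi / L * ∑ i, (k i : ℝ) * X 0 i))) ∧
    hMinusOneSqW L (fun X : Config (N + 1) => Θ₀ (vecTail X))
        (fun X : Config (N + 1) => ∑ k ∈ S,
          (2 * (α k * ∑ j, Real.cos (2 * Real.pi / L * ∑ i, (k i : ℝ) * vecTail X j i) +
                β k * ∑ j, Real.sin (2 * Real.pi / L * ∑ i, (k i : ℝ) * vecTail X j i)) *
              Real.cos (2 * Real.pi / L * ∑ i, (k i : ℝ) * X 0 i) +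
            2 * (α k * ∑ j, Real.sin (2 * Real.pi / L * ∑ i, (k i : ℝ) * vecTail X j i) -
                β k * ∑ j, Real.cos (2 * Real.pi / L * ∑ i, (k i : ℝ) * vecTail X j i)) *
              Real.sin (2 * Real.pi / L * ∑ i, (k i : ℝ) * X 0 i))) ≤
      ENNReal.ofReal (CK * (192 * κ ^ 2 + CU * κ) * N) := by
  have hL : 0 < L := one_pos.trans_le hL1
  -- continuity of the density waves and of the mode coefficients
  have hwave : ∀ (k : Fin 3 → ℤ) {f : ℝ → ℝ}, Continuous f →
      Continuous fun Z : Config N => ∑ j, f (2 * Real.pi / L * ∑ i, (k i : ℝ) * Z j i) := by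
    intro k f hf
    refine continuous_finsetSum _ fun j _ => hf.comp (continuous_const.mul
      (continuous_finsetSum _ fun i _ => continuous_const.mul ?_))
    exact (PiLp.continuous_apply 2 _ i).comp (continuous_apply j)
  have hcoefA : ∀ k : Fin 3 → ℤ, Continuous fun Z : Config N =>
      2 * (α k * ∑ j, Real.cos (2 * Real.pi / L * ∑ i, (k i : ℝ) * Z j i) +
        β k * ∑ j, Real.sin (2 * Real.pi / L * ∑ i, (k i : ℝ) * Z j i)) := fun k =>
    continuous_const.mul ((continuous_const.mul (hwave k Real.continuous_cos)).add
      (continuous_const.mul (hwave k Real.continuous_sin)))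
  have hcoefB : ∀ k : Fin 3 → ℤ, Continuous fun Z : Config N =>
      2 * (α k * ∑ j, Real.sin (2 * Real.pi / L * ∑ i, (k i : ℝ) * Z j i) -
        β k * ∑ j, Real.cos (2 * Real.pi / L * ∑ i, (k i : ℝ) * Z j i)) := fun k =>
    continuous_const.mul ((continuous_const.mul (hwave k Real.continuous_sin)).sub
      (continuous_const.mul (hwave k Real.continuous_cos)))
  refine ⟨?_, ?_⟩
  · have ht := continuous_vecTail_config (N := N)
    refine continuous_finsetSum _ fun k _ => ?_
    exact (((hcoefA k).comp ht).mul ((continuous_cos_modePhase L k).comp (continuous_apply 0))).add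
      (((hcoefB k).comp ht).mul ((continuous_sin_modePhase L k).comp (continuous_apply 0)))
  -- Step 1: orthogonality of the tagged modes
  have h1 := hMinusOneSqW_tail_modes_le N L hL Θ₀ hΘc S hS0 hS
    (fun k Z => 2 * (α k * ∑ j, Real.cos (2 * Real.pi / L * ∑ i, (k i : ℝ) * Z j i) +
      β k * ∑ j, Real.sin (2 * Real.pi / L * ∑ i, (k i : ℝ) * Z j i)))
    (fun k Z => 2 * (α k * ∑ j, Real.sin (2 * Real.pi / L * ∑ i, (k i : ℝ) * Z j i) -
      β k * ∑ j, Real.cos (2 * Real.pi / L * ∑ i, (k i : ℝ) * Z j i)))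
    (fun k _ => hcoefA k) (fun k _ => hcoefB k)
  refine h1.trans ?_
  -- Step 2: the coefficient bound, mode by mode
  set M : (Fin 3 → ℤ) → ℝ := fun k => CK * N / ((2 * Real.pi / L) ^ 2 * ∑ i, (k i : ℝ) ^ 2) with hM
  have hne : ∀ k ∈ S, k ≠ 0 := fun k hk h => hS0 (h ▸ hk)
  have hnsq : ∀ k ∈ S, 0 < ∑ i, (k i : ℝ) ^ 2 := fun k hk => by
    have h1' : (1 : ℝ) ≤ ((univ.sup fun j => (k j).natAbs : ℕ) : ℝ) := by
      exact_mod_cast one_le_supNorm_of_ne_zero (hne k hk)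
    nlinarith [supNorm_sq_le_nsq k]
  have hM0 : ∀ k ∈ S, 0 ≤ M k := fun k hk => by
    have := hnsq k hk
    rw [hM]; positivity
  have h2 : ∀ k ∈ S,
      hMinusOneSqW L Θ₀ (fun Z : Config N =>
          2 * (α k * ∑ j, Real.cos (2 * Real.pi / L * ∑ i, (k i : ℝ) * Z j i) +
            β k * ∑ j, Real.sin (2 * Real.pi / L * ∑ i, (k i : ℝ) * Z j i))) +
        hMinusOneSqW L Θ₀ (fun Z : Config N =>
          2 * (α k * ∑ j, Real.sin (2 * Real.pi / L * ∑ i, (k i : ℝ) * Z j i) -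
            β k * ∑ j, Real.cos (2 * Real.pi / L * ∑ i, (k i : ℝ) * Z j i))) ≤
      ENNReal.ofReal (16 * (α k ^ 2 + β k ^ 2) * M k) := by
    intro k hk
    obtain ⟨hc, hs⟩ := hdict k (hne k hk)
    obtain ⟨ha, hb⟩ := hMinusOneSqW_modeCoeff_le L hΘc (hwave k Real.continuous_cos)
      (hwave k Real.continuous_sin) (hM0 k hk) hc hs (α k) (β k)
    calc _ ≤ ENNReal.ofReal (8 * (α k ^ 2 + β k ^ 2) * M k) +
          ENNReal.ofReal (8 * (α k ^ 2 + β k ^ 2) * M k) := add_le_add ha hb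
      _ = _ := by
          rw [← ENNReal.ofReal_add (by have := hM0 k hk; positivity)
            (by have := hM0 k hk; positivity)]
          congr 1; ring
  -- Step 3: sum, identify with the lattice sum, and bound it
  have hterm : ∀ k ∈ S, L ^ 3 / 2 * (16 * (α k ^ 2 + β k ^ 2) * M k) =
      2 * CK * N * L ^ 5 / Real.pi ^ 2 * ((α k ^ 2 + β k ^ 2) / ∑ i, (k i : ℝ) ^ 2) := by
    intro k hk
    have hn := hnsq k hk
    rw [hM]
    field_simp
    ring
  -- the lattice sum with `c_k = √(α_k² + β_k²)`
  have hlat : ∑ k ∈ S, (α k ^ 2 + β k ^ 2) / ∑ i, (k i : ℝ) ^ 2 ≤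
      96 * ⌈L⌉₊ * ((L ^ 3)⁻¹ * κ) ^ 2 + (L ^ 3)⁻¹ * (CU * κ) / (⌈L⌉₊ : ℝ) ^ 2 := by
    have hsq : ∀ k, Real.sqrt (α k ^ 2 + β k ^ 2) ^ 2 = α k ^ 2 + β k ^ 2 := fun k =>
      Real.sq_sqrt (by positivity)
    have hA' : ∀ k, |Real.sqrt (α k ^ 2 + β k ^ 2)| ≤ (L ^ 3)⁻¹ * κ := fun k => by
      rw [abs_of_nonneg (Real.sqrt_nonneg _)]
      exact Real.sqrt_le_sqrt (hA k) |>.trans_eq (Real.sqrt_sq (by positivity))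
    have hP' : ∀ T : Finset (Fin 3 → ℤ), ∑ k ∈ T, Real.sqrt (α k ^ 2 + β k ^ 2) ^ 2 ≤
        (L ^ 3)⁻¹ * (CU * κ) := fun T => by simp only [hsq]; exact hP T
    have h := sum_sq_div_nsq_le hA' hP' (Nat.one_le_ceil_iff.2 hL) S hS0
    simp only [hsq] at h
    exact h
  -- elementary arithmetic with `L ≤ ⌈L⌉ ≤ 2L` and `2/π² ≤ 1`
  have harith : 2 * CK * N * L ^ 5 / Real.pi ^ 2 *
      (96 * ⌈L⌉₊ * ((L ^ 3)⁻¹ * κ) ^ 2 + (L ^ 3)⁻¹ * (CU * κ) / (⌈L⌉₊ : ℝ) ^ 2) ≤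
        CK * (192 * κ ^ 2 + CU * κ) * N := by
    have hc1 : (L : ℝ) ≤ (⌈L⌉₊ : ℝ) := Nat.le_ceil L
    have hc2 : ((⌈L⌉₊ : ℕ) : ℝ) ≤ 2 * L := by
      have := Nat.ceil_lt_add_one hL.le
      linarith
    have hN : (0 : ℝ) ≤ N := Nat.cast_nonneg N
    have hpi : 2 / Real.pi ^ 2 ≤ 1 := by
      rw [div_le_one (by positivity)]
      nlinarith [Real.pi_gt_three]
    have hIR : 96 * (⌈L⌉₊ : ℝ) * ((L ^ 3)⁻¹ * κ) ^ 2 ≤ 192 * κ ^ 2 / L ^ 5 := by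
      rw [show 96 * (⌈L⌉₊ : ℝ) * ((L ^ 3)⁻¹ * κ) ^ 2 = (⌈L⌉₊ : ℝ) * (96 * κ ^ 2 / L ^ 6) by
        field_simp, show 192 * κ ^ 2 / L ^ 5 = (2 * L) * (96 * κ ^ 2 / L ^ 6) by field_simp; ring]
      exact mul_le_mul_of_nonneg_right hc2 (by positivity)
    have hUV : (L ^ 3)⁻¹ * (CU * κ) / ((⌈L⌉₊ : ℕ) : ℝ) ^ 2 ≤ CU * κ / L ^ 5 := by
      rw [show (CU : ℝ) * κ / L ^ 5 = (L ^ 3)⁻¹ * (CU * κ) / L ^ 2 by field_simp]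
      exact div_le_div_of_nonneg_left (by positivity) (by positivity)
        (pow_le_pow_left₀ hL.le hc1 2)
    calc 2 * CK * N * L ^ 5 / Real.pi ^ 2 *
          (96 * ⌈L⌉₊ * ((L ^ 3)⁻¹ * κ) ^ 2 + (L ^ 3)⁻¹ * (CU * κ) / (⌈L⌉₊ : ℝ) ^ 2)
        ≤ 2 * CK * N * L ^ 5 / Real.pi ^ 2 * (192 * κ ^ 2 / L ^ 5 + CU * κ / L ^ 5) :=
          mul_le_mul_of_nonneg_left (add_le_add hIR hUV) (by positivity)
      _ = 2 / Real.pi ^ 2 * (CK * (192 * κ ^ 2 + CU * κ) * N) := by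
          field_simp
      _ ≤ 1 * (CK * (192 * κ ^ 2 + CU * κ) * N) :=
          mul_le_mul_of_nonneg_right hpi (by positivity)
      _ = _ := one_mul _
  calc ENNReal.ofReal (L ^ 3 / 2) * ∑ k ∈ S,
        (hMinusOneSqW L Θ₀ (fun Z : Config N =>
            2 * (α k * ∑ j, Real.cos (2 * Real.pi / L * ∑ i, (k i : ℝ) * Z j i) +
              β k * ∑ j, Real.sin (2 * Real.pi / L * ∑ i, (k i : ℝ) * Z j i))) +
          hMinusOneSqW L Θ₀ (fun Z : Config N =>
            2 * (α k * ∑ j, Real.sin (2 * Real.pi / L * ∑ i, (k i : ℝ) * Z j i) -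
              β k * ∑ j, Real.cos (2 * Real.pi / L * ∑ i, (k i : ℝ) * Z j i))))
      ≤ ENNReal.ofReal (L ^ 3 / 2) * ∑ k ∈ S, ENNReal.ofReal (16 * (α k ^ 2 + β k ^ 2) * M k) := by
        gcongr with k hk
        exact h2 k hk
    _ = ENNReal.ofReal (∑ k ∈ S, L ^ 3 / 2 * (16 * (α k ^ 2 + β k ^ 2) * M k)) := by
        rw [← ENNReal.ofReal_sum_of_nonneg fun k hk => by have := hM0 k hk; positivity,
          ← ENNReal.ofReal_mul (by positivity), Finset.mul_sum]
    _ = ENNReal.ofReal (2 * CK * N * L ^ 5 / Real.pi ^ 2 *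
          ∑ k ∈ S, (α k ^ 2 + β k ^ 2) / ∑ i, (k i : ℝ) ^ 2) := by
        rw [Finset.sum_congr rfl hterm, ← Finset.mul_sum]
    _ ≤ ENNReal.ofReal (CK * (192 * κ ^ 2 + CU * κ) * N) := by
        refine ENNReal.ofReal_le_ofReal ((mul_le_mul_of_nonneg_left hlat (by positivity)).trans harith)

end Summit.AtomisticToContinuum.BoseEinsteinCondensation.Theorems.CorrectorClosure.ResidueAreaLaw

end
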